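import Summits.CriticalPhenomena.PercolationContinuityZ3.Theorems.PercNearOneGluingNoHeavyLowerTailMajorityGluingQCertSymParts
import HarnessLib

/-!
# Part 13 of 18 of the orbit certificate of the cell `(12,7)` at `c = 157/100`: data and digest (lane prim-rate, constants-miner 1, gen 36; generated by cert/mksym.py)

Support file for the closed crux `NoHeavyLowerTail` (stmt-CriticalPhenomena-4575), majority-gluing line.  The symmetrised certificate of the cell `(12,7)`
(kit j286395, symcert.py) is checked IN PARTS (`…MajorityGluingQCertSymParts`): this file holds part 13 (1 multiplier terms, 1 marginal slacks,
0 rows, 0 squares; 3636 contributions) and its DIGEST `twelveSevenSymP13D` (64 orbit keys), verified by `decide +kernel` (`twelveSevenSymP13_digest`).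
The parts are glued in `…MajorityGluingQCertSymTwelveSeven`.  No sorries. [cite: VandenbergKahn2001, Thm 1.2 (p. 123)]
-/

namespace Summit.CriticalPhenomena.PercolationContinuityZ3.Theorems

namespace HubOnly
namespace QCert

/-- Row representatives of part 13: `(A, X, B, Y, n, masks of f(A,X), f(B,Y), f(A∪B,X∩Y), f(∅,X∪Y))`. -/
def twelveSevenSymP13Rows : List RowE :=
  []

/-- Square representatives of part 13: `(a, b, n, mask₁, mask₂)`. -/
def twelveSevenSymP13Sqs : List SqE :=
  []

/-- **Part 13** of the `(12,7)` orbit certificate at `157/100`. -/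
def twelveSevenSymP13 : SymCert :=
  ⟨⟨12, 7, 157, 100, 1, [], [], []⟩,
    [(255, 239576631935150624)],
    [(0, 63, 135611584154567712)],
    [twelveSevenSymP13Rows], [twelveSevenSymP13Sqs]⟩

/-- The digest of part 13: `(orbit key, coefficient total)` in increasing key order (computed by cert/mksym.py, verified below). -/
def twelveSevenSymP13D : List (ℕ × ℤ) :=
  [((4160 : ℕ), (135611584154567712 : ℤ)), (12354, 678057920772838560), (12416, 813669504927406272), (28742, 1356115841545677120), 
    (28802, 4068347524637031360), (28928, 2034173762318515680), (61518, 1356115841545677120), (61574, 8136695049274062720), 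
    (61698, 10170868811592578400), (61952, 2712231683091354240), (127070, 678057920772838560), (127118, 8136695049274062720), 
    (127238, 20341737623185156800), (127490, 13561158415456771200), (128000, 2034173762318515680), (258174, 135611584154567712), 
    (258206, 4068347524637031360), (258238, 813669504927406272), (258318, 20341737623185156800), (258334, 10170868811592578400), 
    (258366, 2034173762318515680), (258566, 27122316830913542400), (258574, 27122316830913542400), (258590, 13561158415456771200), 
    (258622, 2712231683091354240), (259074, 10170868811592578400), (259078, 20341737623185156800), (259086, 20341737623185156800), 
    (259102, 10170868811592578400), (259134, 2034173762318515680), (260096, 813669504927406272), (260098, 4068347524637031360), 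
    (260102, 8136695049274062720), (260110, 8136695049274062720), (260126, 4068347524637031360), (260158, 813669504927406272), 
    (262144, 135611584154567712), (262146, 678057920772838560), (262150, 1356115841545677120), (262158, 1356115841545677120), 
    (262174, 678057920772838560), (262206, 135611584154567712), (520574, -191661305548120499200), (520766, -2683258277673686988800), 
    (521246, -8049774833021060966400), (522254, -6708145694184217472000), (524294, -1341629138836843494400), (1044990, -23957663193515062400), 
    (1045118, -766645222192481996800), (1045246, -95830652774060249600), (1045566, -4024887416510530483200), (1045630, -1149967833288722995200), 
    (1045758, -143745979161090374400), (1046558, -5366516555347373977600), (1046590, -2683258277673686988800), (1046654, -766645222192481996800), 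
    (1046782, -95830652774060249600), (1048590, -1677036423546054368000), (1048606, -1341629138836843494400), (1048638, -670814569418421747200), 
    (1048702, -191661305548120499200), (1048830, -23957663193515062400), (16781375, -135611584154567712), (16781567, 37613531213818647968)]

/-- **The digest of part 13 is `twelveSevenSymP13D`** (kernel evaluation of the part's 3636 contributions). -/
theorem twelveSevenSymP13_digest : twelveSevenSymP13.digest 20 = twelveSevenSymP13D := by
  decide +kernel

end QCert
end HubOnly

end Summit.CriticalPhenomena.PercolationContinuityZ3.Theorems
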